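import Literature.MathematicalPhysics.QuantumFieldTheory.Balaban1983to89.B4Eq19LatticeOperators
import HarnessLib

/-!
# Line «sandwich_discharge» on crux `HistoryTailL` (stmt-QuantumFields-19936), stub `stub_sandwichSweepGapCapped` (S′), brick B5 on `ℤ³` —
# «MATCHED-CHARGE FIELD BOUNDS FROM KERNEL DIFFERENCE HYPOTHESES»: the far field of `K ∗ ω` for a MEAN-ZERO charge `ω`, its dyadic-shell
# sum, and the near `ℓ¹` mass of `K ∗ ω` — for an ARBITRARY kernel `K` on `ℤ^d` whose size ∕ first differences are hypotheses

Cell `ym3-torus` (YM ladder rung R3 = continuum SU(2) Yang–Mills on the three-torus — a RUNG, NOT the Clay problem: not d = 4, not infinite volume,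
not a mass gap); TWIN-WIDTH helper seat `ym-ust-19936-w8` gen 8; `--supports stmt-QuantumFields-19936` (helper).  THEOREMS ONLY (0 `def`, default
heartbeats), in the `ℤ^d` letters of lit ✓`B4Eq19LatticeOperators` (`Zd`, `unitVec`, `box`).

WHY (LOCATE-B5-Z3-COMMUTATOR-w8g8, 19936 evidence #47, brick (Z-c)).  In px8 g6's ARCH-S′ for the capped sweep stub, brick B5 builds the sweep amplitude from the
dipole-MATCHED averaged-plaquette 2-form `ω` (`Σω = 0`); on `ℤ³` it is `δ₂(G₀ ∗ ω)` with the FREE lattice Green kernel `G₀` (lit ✓`LatticeGreenPoisson`), and after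
the commutator truncation every error term is a FIRST difference of `G₀ ∗ ω` on a dyadic shell, i.e. `K ∗ ω` with `K = ∇G₀`, `|∇K(z)| ≤ C₂|z|^{−3}` (lit
✓`LatticeGreenGradient.latticeGreen_second_diff_bound`), `|K(z)| ≤ C₁|z|^{−2}` (✓`latticeGreen_gradient_bound`).  THIS FILE is the kernel-independent
bookkeeping: `K` and its two decay laws are HYPOTHESES in sup-norm `box` language (the consumer discharges them from the Euclidean lit bounds, `‖z‖_∞ ≤ |z|`):
* §1 `abs_sub_le_of_path_steps` — LATTICE TAYLOR ALONG AXIS PATHS (any `d`): unit steps in the coordinate hull cost `≤ B` ⇒ `|K z′ − K z| ≤ B·‖z′ − z‖₁`;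
* §2 `abs_sum_mul_le_of_sum_eq_zero` ∕ `abs_sum_mul_le_of_decay` — FAR FIELD OF A MEAN-ZERO CHARGE (any `d`): `|Σ_y K(x−y)ω y| ≤ B·M₁(ω)`
  (`M₁ = Σ_y ‖y−p‖₁|ω y|`); with `|K(w+e_i) − K w| ≤ C₂∕n^q` on `‖w‖_∞ ≥ n ≥ 2` and `‖x−p‖_∞ ≥ N ≥ 2ℓ+2`: `≤ (2^q C₂∕N^q)·M₁(ω)`;
* §3 `shell_sum_far_field_le` — DYADIC SHELL SUM (`d = q = 3`): `Σ_{x ∈ box p (2N) ∖ box p (N−1)} |(K∗ω)(x)| ≤ 1000·C₂·M₁(ω)`;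
* §4 `card_shell_eq` (`#shell(n) = 24n² + 2`), `sum_box_abs_le_of_decay` (`|K w| ≤ C₁∕n²` on `‖w‖_∞ ≥ n ≥ 1` ⇒ `Σ_{box 0 R}|K| ≤ |K 0| + 26C₁R`);
* §5 `sum_box_abs_sum_mul_le` — NEAR `ℓ¹` MASS: `Σ_{x ∈ box p N}|Σ_y K(x−y)ω y| ≤ (|K 0| + 26C₁(N+ℓ))·Σ_y|ω y|` (`d = 3`).
Text-independent of the stub, of bricks (Z-a)(Z-b)(Z-d); the knit (Z-e) instantiates `K := ∇_e G₀`.  HONEST SCOPE: elementary finite sums; NOTHING here proves B5,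
the capped stub, `HistoryTailL`, or any summit statement; YM₃ on T³ is rung R3, not Clay. [folklore] (cf. Lawler, *Intersections of Random Walks* (1991) §1.5).
-/

noncomputable section

open scoped BigOperators
open Finset

namespace Summit.QuantumFields.YangMills.Theorems.CovariantDischargeMatchedChargeKernelBounds

open Literature.MathematicalPhysics.QuantumFieldTheory.Balaban1983to89.B4Eq19LatticeOperators

variable {d : ℕ}

/-! ## §1 Lattice Taylor along axis paths -/

/-- The coordinate hull of two lattice points: `w` lies between `z` and `z′` coordinatewise. (Inlined everywhere; this lemma only records that the
endpoints belong to it.) [folklore] -/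
theorem mem_hull_left (z z' : Zd d) : ∀ i, min (z i) (z' i) ≤ z i ∧ z i ≤ max (z i) (z' i) :=
  fun _ => ⟨min_le_left _ _, le_max_left _ _⟩

/-- `(w + e_i)_i = w_i + 1`. [folklore] -/
theorem add_unitVec_apply_self (w : Zd d) (i : Fin d) : (w + unitVec i) i = w i + 1 := by simp

/-- `(w + e_i)_j = w_j` for `j ≠ i`. [folklore] -/
theorem add_unitVec_apply_ne (w : Zd d) {i j : Fin d} (h : j ≠ i) : (w + unitVec i) j = w j := by simp [unitVec_apply_ne h]

/-- `(w − e_i)_i = w_i − 1`. [folklore] -/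
theorem sub_unitVec_apply_self (w : Zd d) (i : Fin d) : (w - unitVec i) i = w i - 1 := by simp

/-- `(w − e_i)_j = w_j` for `j ≠ i`. [folklore] -/
theorem sub_unitVec_apply_ne (w : Zd d) {i j : Fin d} (h : j ≠ i) : (w - unitVec i) j = w j := by simp [unitVec_apply_ne h]

/-- The `ℓ¹` lattice distance as a natural number vanishes only at equal points. [folklore] -/
theorem eq_of_sum_natAbs_eq_zero {z z' : Zd d} (h : ∑ i, (z' i - z i).natAbs = 0) : z' = z := by
  funext i
  have hi := (Finset.sum_eq_zero_iff.1 h) i (Finset.mem_univ i)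
  have : z' i - z i = 0 := Int.natAbs_eq_zero.1 hi
  linarith

/-- ★ **LATTICE TAYLOR ALONG AXIS PATHS.**  If every forward unit step of `K` taken from a point of the coordinate hull of `z` and `z′` costs at most
`B`, then `|K z′ − K z| ≤ B · Σ_i |z′_i − z_i|` (walk one unit at a time towards `z′`; each step stays in the hull). [folklore] -/
theorem abs_sub_le_of_path_steps (K : Zd d → ℝ) (B : ℝ) :
    ∀ (n : ℕ) (z z' : Zd d), ∑ i, (z' i - z i).natAbs = n →
      (∀ w : Zd d, (∀ i, min (z i) (z' i) ≤ w i ∧ w i ≤ max (z i) (z' i)) → ∀ i, |K (w + unitVec i) - K w| ≤ B) →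
      |K z' - K z| ≤ B * n := by
  intro n
  induction n with
  | zero => intro z z' hn _; rw [eq_of_sum_natAbs_eq_zero hn]; simp
  | succ k ih =>
      intro z z' hn hstep
      -- some coordinate differs
      have hex : ∃ i, z' i ≠ z i := by
        by_contra hcon
        have hall : ∀ i, z' i = z i := fun i => by_contra fun h => hcon ⟨i, h⟩
        have : ∑ i, (z' i - z i).natAbs = 0 := Finset.sum_eq_zero fun i _ => by simp [hall i]
        omega
      obtain ⟨i, hi⟩ := hex
      -- move one unit along axis `i` towards `z'`
      rcases lt_or_gt_of_ne hi with hlt | hgt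
      · -- `z' i < z i`: step DOWN from `z`; the step bound is read at `z − e_i`, which lies in the hull
        set z'' : Zd d := z - unitVec i with hz''
        have hz''i : z'' i = z i - 1 := sub_unitVec_apply_self z i
        have hz''j : ∀ j, j ≠ i → z'' j = z j := fun j hj => sub_unitVec_apply_ne z hj
        have hmem : ∀ j, min (z j) (z' j) ≤ z'' j ∧ z'' j ≤ max (z j) (z' j) := by
          intro j
          by_cases hj : j = i
          · subst hj; rw [hz''i]
            exact ⟨by rw [min_eq_right hlt.le]; omega, by rw [max_eq_left hlt.le]; omega⟩
          · rw [hz''j j hj]; exact mem_hull_left z z' j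
        have hstep1 : |K z - K z''| ≤ B := by
          have := hstep z'' hmem i
          rwa [hz'', sub_add_cancel] at this
        -- distance from `z''` to `z'` is `k`
        have hdist : ∑ j, (z' j - z'' j).natAbs = k := by
          have hsplit : ∀ j, (z' j - z'' j).natAbs = (z' j - z j).natAbs - if j = i then 1 else 0 := by
            intro j
            by_cases hj : j = i
            · subst hj; rw [hz''i, if_pos rfl]; omega
            · rw [hz''j j hj, if_neg hj]; omega
          have hle : ∀ j ∈ (Finset.univ : Finset (Fin d)), (if j = i then 1 else 0) ≤ (z' j - z j).natAbs := by
            intro j _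
            by_cases hj : j = i
            · subst hj; rw [if_pos rfl]; omega
            · rw [if_neg hj]; exact Nat.zero_le _
          simp_rw [hsplit]
          rw [Finset.sum_tsub_distrib _ hle, hn, Finset.sum_ite_eq' Finset.univ i, if_pos (Finset.mem_univ i)]
          omega
        -- the hull shrinks
        have hsub : ∀ w : Zd d, (∀ j, min (z'' j) (z' j) ≤ w j ∧ w j ≤ max (z'' j) (z' j)) →
            ∀ j, min (z j) (z' j) ≤ w j ∧ w j ≤ max (z j) (z' j) := by
          intro w hw j
          obtain ⟨h1, h2⟩ := hw j
          by_cases hj : j = i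
          · subst hj
            rw [hz''i] at h1 h2
            exact ⟨by rw [min_eq_right hlt.le]; rw [min_eq_right (by omega)] at h1; exact h1,
              by rw [max_eq_left hlt.le]; rw [max_eq_left (by omega)] at h2; omega⟩
          · rw [hz''j j hj] at h1 h2; exact ⟨h1, h2⟩
        have hrest : |K z' - K z''| ≤ B * k := ih z'' z' hdist fun w hw => hstep w (hsub w hw)
        calc |K z' - K z| = |(K z' - K z'') + (K z'' - K z)| := by ring_nf
          _ ≤ |K z' - K z''| + |K z'' - K z| := abs_add_le _ _
          _ ≤ B * k + B := by rw [abs_sub_comm (K z'') (K z)]; exact add_le_add hrest hstep1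
          _ = B * (k + 1 : ℕ) := by push_cast; ring
      · -- `z i < z' i`: step UP from `z`
        set z'' : Zd d := z + unitVec i with hz''
        have hz''i : z'' i = z i + 1 := add_unitVec_apply_self z i
        have hz''j : ∀ j, j ≠ i → z'' j = z j := fun j hj => add_unitVec_apply_ne z hj
        have hstep1 : |K z'' - K z| ≤ B := hstep z (mem_hull_left z z') i
        have hdist : ∑ j, (z' j - z'' j).natAbs = k := by
          have hsplit : ∀ j, (z' j - z'' j).natAbs = (z' j - z j).natAbs - if j = i then 1 else 0 := by
            intro j
            by_cases hj : j = i
            · subst hj; rw [hz''i, if_pos rfl]; omega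
            · rw [hz''j j hj, if_neg hj]; omega
          have hle : ∀ j ∈ (Finset.univ : Finset (Fin d)), (if j = i then 1 else 0) ≤ (z' j - z j).natAbs := by
            intro j _
            by_cases hj : j = i
            · subst hj; rw [if_pos rfl]; omega
            · rw [if_neg hj]; exact Nat.zero_le _
          simp_rw [hsplit]
          rw [Finset.sum_tsub_distrib _ hle, hn, Finset.sum_ite_eq' Finset.univ i, if_pos (Finset.mem_univ i)]
          omega
        have hsub : ∀ w : Zd d, (∀ j, min (z'' j) (z' j) ≤ w j ∧ w j ≤ max (z'' j) (z' j)) →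
            ∀ j, min (z j) (z' j) ≤ w j ∧ w j ≤ max (z j) (z' j) := by
          intro w hw j
          obtain ⟨h1, h2⟩ := hw j
          by_cases hj : j = i
          · subst hj
            rw [hz''i] at h1 h2
            exact ⟨by rw [min_eq_left hgt.le]; rw [min_eq_left (by omega)] at h1; omega,
              by rw [max_eq_right hgt.le]; rw [max_eq_right (by omega)] at h2; exact h2⟩
          · rw [hz''j j hj] at h1 h2; exact ⟨h1, h2⟩
        have hrest : |K z' - K z''| ≤ B * k := ih z'' z' hdist fun w hw => hstep w (hsub w hw)
        calc |K z' - K z| = |(K z' - K z'') + (K z'' - K z)| := by ring_nf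
          _ ≤ |K z' - K z''| + |K z'' - K z| := abs_add_le _ _
          _ ≤ B * k + B := add_le_add hrest hstep1
          _ = B * (k + 1 : ℕ) := by push_cast; ring

/-- The `ℓ¹` distance, cast to `ℝ`. [folklore] -/
theorem cast_sum_natAbs (z z' : Zd d) :
    ((∑ i, (z' i - z i).natAbs : ℕ) : ℝ) = ∑ i, |((z' i - z i : ℤ) : ℝ)| := by
  push_cast
  refine Finset.sum_congr rfl fun i _ => ?_
  rw [Nat.cast_natAbs, Int.cast_abs, Int.cast_sub]

/-! ## §2 The far field of a mean-zero charge -/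

/-- Points of `box p ℓ` lie in the coordinate hull condition used below: if `y ∈ box p ℓ` and `w` is coordinatewise between `x − p` and `x − y`,
then `x − w ∈ box p ℓ`. [folklore] -/
theorem sub_mem_box_of_hull {p y x w : Zd d} {ℓ : ℤ} (hy : y ∈ box p ℓ)
    (hw : ∀ i, min ((x - p) i) ((x - y) i) ≤ w i ∧ w i ≤ max ((x - p) i) ((x - y) i)) : x - w ∈ box p ℓ := by
  rw [mem_box] at hy ⊢
  intro i
  obtain ⟨h1, h2⟩ := hw i
  have hyi := hy i
  have hℓ : 0 ≤ ℓ := (abs_nonneg _).trans hyi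
  simp only [Pi.sub_apply] at h1 h2 hyi ⊢
  rw [abs_le] at hyi ⊢
  constructor
  · have := le_max_iff.1 (le_of_eq rfl : max (x i - p i) (x i - y i) ≤ max (x i - p i) (x i - y i))
    rcases le_total (x i - p i) (x i - y i) with hc | hc
    · rw [max_eq_right hc] at h2; linarith
    · rw [max_eq_left hc] at h2; linarith
  · rcases le_total (x i - p i) (x i - y i) with hc | hc
    · rw [min_eq_left hc] at h1; linarith
    · rw [min_eq_right hc] at h1; linarith

/-- ★★ **THE FAR FIELD OF A MEAN-ZERO CHARGE** (abstract step bound).  If `ω` is supported in `box p ℓ` (the sum below ranges over it) with `Σ_y ω y = 0`,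
and every forward unit step of `K` from a point of `x − box p ℓ` costs at most `B`, then
`|Σ_{y ∈ box p ℓ} K(x − y)·ω y| ≤ B · Σ_{y ∈ box p ℓ} ‖y − p‖₁·|ω y|` — the monopole cancels, the dipole moment pays `B` per unit of `ℓ¹` distance. [folklore] -/
theorem abs_sum_mul_le_of_sum_eq_zero (K : Zd d → ℝ) (B : ℝ) (ω : Zd d → ℝ) (p x : Zd d) (ℓ : ℤ)
    (hsum : ∑ y ∈ box p ℓ, ω y = 0)
    (hstep : ∀ w : Zd d, x - w ∈ box p ℓ → ∀ i, |K (w + unitVec i) - K w| ≤ B) :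
    |∑ y ∈ box p ℓ, K (x - y) * ω y| ≤ B * ∑ y ∈ box p ℓ, (∑ i, |((y i - p i : ℤ) : ℝ)|) * |ω y| := by
  -- subtract the monopole
  have hrw : ∑ y ∈ box p ℓ, K (x - y) * ω y = ∑ y ∈ box p ℓ, (K (x - y) - K (x - p)) * ω y := by
    have : ∑ y ∈ box p ℓ, K (x - p) * ω y = 0 := by rw [← Finset.mul_sum, hsum, mul_zero]
    rw [← sub_zero (∑ y ∈ box p ℓ, K (x - y) * ω y), ← this, ← Finset.sum_sub_distrib]
    refine Finset.sum_congr rfl fun y _ => by ring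
  rw [hrw, Finset.mul_sum]
  refine (Finset.abs_sum_le_sum_abs _ _).trans (Finset.sum_le_sum fun y hy => ?_)
  rw [abs_mul, ← mul_assoc]
  refine mul_le_mul_of_nonneg_right ?_ (abs_nonneg _)
  -- lattice Taylor from `x − p` to `x − y`
  have hpath := abs_sub_le_of_path_steps K B (∑ i, ((x - y) i - (x - p) i).natAbs) (x - p) (x - y) rfl
    (fun w hw => hstep w (sub_mem_box_of_hull hy hw))
  rw [cast_sum_natAbs] at hpath
  refine hpath.trans (le_of_eq ?_)
  congr 1
  refine Finset.sum_congr rfl fun i _ => ?_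
  simp only [Pi.sub_apply]
  rw [show ((x i - y i - (x i - p i) : ℤ) : ℝ) = -(((y i - p i : ℤ) : ℝ)) by push_cast; ring, abs_neg]

/-- Sup-norm bookkeeping: if `‖x − p‖_∞ ≥ N` (`x ∉ box p (N − 1)`) and `‖w′‖_∞ ≤ ℓ` (`x − w ∈ box p ℓ`), then `‖w‖_∞ ≥ N − ℓ`
(`w ∉ box 0 (N − ℓ − 1)`). [folklore] -/
theorem not_mem_box_zero_of_far {p x w : Zd d} {ℓ N : ℤ} (hx : x ∉ box p (N - 1)) (hw : x - w ∈ box p ℓ) :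
    w ∉ box 0 (N - ℓ - 1) := by
  intro hcon
  apply hx
  rw [mem_box] at hw hcon ⊢
  intro i
  have h1 := hw i
  have h2 := hcon i
  simp only [Pi.sub_apply, Pi.zero_apply, sub_zero] at h1 h2 ⊢
  have : x i - p i = (x i - w i - p i) + w i := by ring
  rw [this]
  refine (abs_add_le _ _).trans ?_
  linarith

/-- ★★ **THE FAR FIELD OF A MEAN-ZERO CHARGE, DECAY FORM.**  Suppose the first differences of `K` decay like `n^{−q}` in the sup norm:
`|K(w + e_i) − K w| ≤ C₂∕n^q` whenever `‖w‖_∞ ≥ n ≥ 2` (`w ∉ box 0 (n−1)`).  If `ω` on `box p ℓ` has `Σω = 0`, then for every `x` with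
`‖x − p‖_∞ ≥ N`, `N ≥ 2ℓ + 2`:  `|Σ_y K(x−y)ω y| ≤ (2^q·C₂∕N^q) · Σ_y ‖y−p‖₁|ω y|`. [folklore] -/
theorem abs_sum_mul_le_of_decay (K : Zd d → ℝ) {C₂ : ℝ} (hC₂ : 0 ≤ C₂) (q : ℕ)
    (hK : ∀ (w : Zd d) (n : ℕ), 2 ≤ n → w ∉ box 0 ((n : ℤ) - 1) → ∀ i, |K (w + unitVec i) - K w| ≤ C₂ / (n : ℝ) ^ q)
    (ω : Zd d → ℝ) (p : Zd d) (ℓ : ℕ) (hsum : ∑ y ∈ box p ℓ, ω y = 0)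
    (x : Zd d) (N : ℕ) (hN : 2 * ℓ + 2 ≤ N) (hx : x ∉ box p ((N : ℤ) - 1)) :
    |∑ y ∈ box p ℓ, K (x - y) * ω y| ≤ (2 ^ q * C₂ / (N : ℝ) ^ q) * ∑ y ∈ box p ℓ, (∑ i, |((y i - p i : ℤ) : ℝ)|) * |ω y| := by
  have hNℓ : 2 ≤ N - ℓ := by omega
  have hNpos : (0 : ℝ) < N := by exact_mod_cast (show 0 < N by omega)
  have hmpos : (0 : ℝ) < ((N - ℓ : ℕ) : ℝ) := by exact_mod_cast (show 0 < N - ℓ by omega)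
  -- the step bound on `x − box p ℓ`
  have hstep : ∀ w : Zd d, x - w ∈ box p ℓ → ∀ i, |K (w + unitVec i) - K w| ≤ C₂ / ((N - ℓ : ℕ) : ℝ) ^ q := by
    intro w hw i
    refine hK w (N - ℓ) hNℓ ?_ i
    have := not_mem_box_zero_of_far (ℓ := ℓ) (N := N) hx hw
    rwa [show ((N : ℤ) - (ℓ : ℕ) - 1) = ((N - ℓ : ℕ) : ℤ) - 1 by push_cast [Nat.cast_sub (by omega : ℓ ≤ N)]; ring] at this
  refine (abs_sum_mul_le_of_sum_eq_zero K _ ω p x ℓ hsum hstep).trans ?_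
  refine mul_le_mul_of_nonneg_right ?_ (Finset.sum_nonneg fun y _ => by positivity)
  -- `C₂∕(N−ℓ)^q ≤ 2^q C₂∕N^q` since `N ≤ 2(N−ℓ)`
  have h2 : (N : ℝ) ≤ 2 * ((N - ℓ : ℕ) : ℝ) := by
    rw [Nat.cast_sub (by omega : ℓ ≤ N)]
    have : (2 * ℓ + 2 : ℝ) ≤ N := by exact_mod_cast hN
    linarith
  rw [div_le_div_iff₀ (by positivity) (by positivity)]
  calc C₂ * (N : ℝ) ^ q ≤ C₂ * (2 * ((N - ℓ : ℕ) : ℝ)) ^ q :=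
        mul_le_mul_of_nonneg_left (pow_le_pow_left₀ hNpos.le h2 q) hC₂
    _ = 2 ^ q * C₂ * ((N - ℓ : ℕ) : ℝ) ^ q := by rw [mul_pow]; ring

/-! ## §3 The dyadic shell sum of the far field (`d = 3`, `q = 3`) -/

/-- The far field summed over ANY finite set of far points is at most `#S` times the pointwise bound. [folklore] -/
theorem sum_abs_sum_mul_le_card_mul (K : Zd d → ℝ) {C₂ : ℝ} (hC₂ : 0 ≤ C₂) (q : ℕ)
    (hK : ∀ (w : Zd d) (n : ℕ), 2 ≤ n → w ∉ box 0 ((n : ℤ) - 1) → ∀ i, |K (w + unitVec i) - K w| ≤ C₂ / (n : ℝ) ^ q)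
    (ω : Zd d → ℝ) (p : Zd d) (ℓ : ℕ) (hsum : ∑ y ∈ box p ℓ, ω y = 0)
    (N : ℕ) (hN : 2 * ℓ + 2 ≤ N) (S : Finset (Zd d)) (hS : ∀ x ∈ S, x ∉ box p ((N : ℤ) - 1)) :
    ∑ x ∈ S, |∑ y ∈ box p ℓ, K (x - y) * ω y| ≤
      S.card * ((2 ^ q * C₂ / (N : ℝ) ^ q) * ∑ y ∈ box p ℓ, (∑ i, |((y i - p i : ℤ) : ℝ)|) * |ω y|) := by
  have h := fun x hx => abs_sum_mul_le_of_decay K hC₂ q hK ω p ℓ hsum x N hN (hS x hx)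
  calc ∑ x ∈ S, |∑ y ∈ box p ℓ, K (x - y) * ω y|
      ≤ ∑ _x ∈ S, (2 ^ q * C₂ / (N : ℝ) ^ q) * ∑ y ∈ box p ℓ, (∑ i, |((y i - p i : ℤ) : ℝ)|) * |ω y| := Finset.sum_le_sum h
    _ = S.card * ((2 ^ q * C₂ / (N : ℝ) ^ q) * ∑ y ∈ box p ℓ, (∑ i, |((y i - p i : ℤ) : ℝ)|) * |ω y|) := by
        rw [Finset.sum_const, nsmul_eq_mul]

/-- ★★ **THE DYADIC SHELL SUM** (`d = 3`, third-order decay): over the shell `box p (2N) ∖ box p (N−1)` (all points with `N ≤ ‖x−p‖_∞ ≤ 2N`),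
`Σ_x |Σ_y K(x−y)ω y| ≤ 1000·C₂·M₁(ω)` — `#box p (2N) = (4N+1)³ ≤ 125N³` against the pointwise `8C₂M₁∕N³`. [folklore] -/
theorem shell_sum_far_field_le (K : Zd 3 → ℝ) {C₂ : ℝ} (hC₂ : 0 ≤ C₂)
    (hK : ∀ (w : Zd 3) (n : ℕ), 2 ≤ n → w ∉ box 0 ((n : ℤ) - 1) → ∀ i, |K (w + unitVec i) - K w| ≤ C₂ / (n : ℝ) ^ 3)
    (ω : Zd 3 → ℝ) (p : Zd 3) (ℓ : ℕ) (hsum : ∑ y ∈ box p ℓ, ω y = 0) (N : ℕ) (hN : 2 * ℓ + 2 ≤ N) :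
    ∑ x ∈ box p (2 * N) \ box p ((N : ℤ) - 1), |∑ y ∈ box p ℓ, K (x - y) * ω y| ≤
      1000 * C₂ * ∑ y ∈ box p ℓ, (∑ i, |((y i - p i : ℤ) : ℝ)|) * |ω y| := by
  set M₁ : ℝ := ∑ y ∈ box p ℓ, (∑ i, |((y i - p i : ℤ) : ℝ)|) * |ω y| with hM₁
  have hM₁0 : 0 ≤ M₁ := Finset.sum_nonneg fun y _ => by positivity
  have hNpos : (0 : ℝ) < N := by exact_mod_cast (show 0 < N by omega)
  have hS : ∀ x ∈ box p (2 * N) \ box p ((N : ℤ) - 1), x ∉ box p ((N : ℤ) - 1) := fun x hx => (Finset.mem_sdiff.1 hx).2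
  refine (sum_abs_sum_mul_le_card_mul K hC₂ 3 hK ω p ℓ hsum N hN _ hS).trans ?_
  -- cardinality of the shell ≤ cardinality of the big box = (4N+1)³ ≤ 125 N³
  have hcard : (((box p (2 * N) \ box p ((N : ℤ) - 1)).card : ℕ) : ℝ) ≤ 125 * (N : ℝ) ^ 3 := by
    have h1 : (((box p (2 * N) \ box p ((N : ℤ) - 1)).card : ℕ) : ℝ) ≤ ((box p (2 * (N : ℤ))).card : ℝ) := by
      exact_mod_cast Finset.card_le_card Finset.sdiff_subset
    have h2 : ((box p (2 * (N : ℤ))).card : ℝ) = ((2 * (2 * (N : ℤ)) + 1 : ℤ) : ℝ) ^ 3 := card_box p (by positivity)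
    rw [h2] at h1
    refine h1.trans ?_
    push_cast
    have : (1 : ℝ) ≤ N := by exact_mod_cast (show 1 ≤ N by omega)
    have h45 : 2 * (2 * (N : ℝ)) + 1 ≤ 5 * N := by linarith
    calc (2 * (2 * (N : ℝ)) + 1) ^ 3 ≤ (5 * (N : ℝ)) ^ 3 := pow_le_pow_left₀ (by positivity) h45 3
      _ = 125 * (N : ℝ) ^ 3 := by ring
  calc (((box p (2 * N) \ box p ((N : ℤ) - 1)).card : ℕ) : ℝ) * ((2 ^ 3 * C₂ / (N : ℝ) ^ 3) * M₁)
      ≤ (125 * (N : ℝ) ^ 3) * ((2 ^ 3 * C₂ / (N : ℝ) ^ 3) * M₁) := mul_le_mul_of_nonneg_right hcard (by positivity)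
    _ = 1000 * C₂ * M₁ := by field_simp; ring

/-! ## §4 Shell counts and the near `ℓ¹` mass of a kernel with second-order decay (`d = 3`) -/

/-- **The shell count**: `#(box 0 n ∖ box 0 (n−1)) = (2n+1)³ − (2n−1)³ = 24n² + 2` for `n ≥ 1`. [folklore] -/
theorem card_shell_eq (n : ℕ) (hn : 1 ≤ n) :
    (((box (0 : Zd 3) n \ box (0 : Zd 3) ((n : ℤ) - 1)).card : ℕ) : ℝ) = 24 * (n : ℝ) ^ 2 + 2 := by
  have hsub : box (0 : Zd 3) ((n : ℤ) - 1) ⊆ box (0 : Zd 3) n := box_mono 0 (by omega)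
  rw [Finset.card_sdiff_of_subset hsub, Nat.cast_sub (Finset.card_le_card hsub)]
  rw [card_box 0 (by positivity : (0 : ℤ) ≤ n), card_box 0 (by omega : (0 : ℤ) ≤ (n : ℤ) - 1)]
  push_cast
  ring

/-- One shell of a kernel with `|K w| ≤ C₁∕n²` on `‖w‖_∞ = n ≥ 1` has mass `≤ 26·C₁`. [folklore] -/
theorem sum_shell_abs_le (K : Zd 3 → ℝ) {C₁ : ℝ} (hC₁ : 0 ≤ C₁)
    (hK : ∀ (w : Zd 3) (n : ℕ), 1 ≤ n → w ∉ box 0 ((n : ℤ) - 1) → |K w| ≤ C₁ / (n : ℝ) ^ 2) (n : ℕ) (hn : 1 ≤ n) :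
    ∑ w ∈ box (0 : Zd 3) n \ box (0 : Zd 3) ((n : ℤ) - 1), |K w| ≤ 26 * C₁ := by
  have hnpos : (0 : ℝ) < n := by exact_mod_cast hn
  have hpt : ∀ w ∈ box (0 : Zd 3) n \ box (0 : Zd 3) ((n : ℤ) - 1), |K w| ≤ C₁ / (n : ℝ) ^ 2 :=
    fun w hw => hK w n hn (Finset.mem_sdiff.1 hw).2
  refine (Finset.sum_le_sum hpt).trans ?_
  rw [Finset.sum_const, nsmul_eq_mul, card_shell_eq n hn]
  have h1 : (1 : ℝ) ≤ n := by exact_mod_cast hn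
  rw [show (24 * (n : ℝ) ^ 2 + 2) * (C₁ / (n : ℝ) ^ 2) = 24 * C₁ + 2 * C₁ / (n : ℝ) ^ 2 by field_simp]
  have : 2 * C₁ / (n : ℝ) ^ 2 ≤ 2 * C₁ := by
    rw [div_le_iff₀ (by positivity)]
    have hn2 : (1 : ℝ) ≤ (n : ℝ) ^ 2 := by nlinarith [h1]
    nlinarith [mul_le_mul_of_nonneg_left hn2 (by linarith : (0 : ℝ) ≤ 2 * C₁)]
  linarith

/-- ★ **NEAR `ℓ¹` MASS OF THE KERNEL**: with `|K w| ≤ C₁∕n²` on `‖w‖_∞ = n ≥ 1`, `Σ_{w ∈ box 0 R}|K w| ≤ |K 0| + 26·C₁·R` (shell by shell). [folklore] -/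
theorem sum_box_abs_le_of_decay (K : Zd 3 → ℝ) {C₁ : ℝ} (hC₁ : 0 ≤ C₁)
    (hK : ∀ (w : Zd 3) (n : ℕ), 1 ≤ n → w ∉ box 0 ((n : ℤ) - 1) → |K w| ≤ C₁ / (n : ℝ) ^ 2) :
    ∀ R : ℕ, ∑ w ∈ box (0 : Zd 3) R, |K w| ≤ |K 0| + 26 * C₁ * R := by
  intro R
  induction R with
  | zero =>
      have : box (0 : Zd 3) ((0 : ℕ) : ℤ) = {0} := by
        ext w
        rw [mem_box, Finset.mem_singleton]
        constructor
        · intro h; funext i; have := h i; simp only [Pi.zero_apply, sub_zero, Nat.cast_zero, abs_nonpos_iff] at this; exact this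
        · intro h i; subst h; simp
      rw [this, Finset.sum_singleton]
      simp
  | succ R ih =>
      have hsub : box (0 : Zd 3) (R : ℤ) ⊆ box (0 : Zd 3) ((R + 1 : ℕ) : ℤ) := box_mono 0 (by push_cast; linarith)
      rw [← Finset.sum_sdiff hsub]
      have hshell := sum_shell_abs_le K hC₁ hK (R + 1) (by omega)
      rw [show (((R + 1 : ℕ) : ℤ) - 1) = (R : ℤ) by push_cast; ring] at hshell
      push_cast at hshell ⊢
      linarith

/-! ## §5 The near `ℓ¹` mass of `K ∗ ω` (`d = 3`) -/

/-- A translated box inside a centred one: `‖y − p‖_∞ ≤ ℓ` ⇒ `box (p − y) N ⊆ box 0 (N + ℓ)`. [folklore] -/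
theorem box_sub_subset {p y : Zd d} {ℓ N : ℤ} (hy : y ∈ box p ℓ) : box (p - y) N ⊆ box 0 (N + ℓ) := by
  refine box_subset_box fun i => ?_
  rw [mem_box] at hy
  have := hy i
  simp only [Pi.sub_apply, Pi.zero_apply, sub_zero]
  rw [abs_sub_comm] at this
  linarith

/-- ★★ **NEAR `ℓ¹` MASS OF THE CONVOLUTION**: for `ω` on `box p ℓ` and a kernel with `|K w| ≤ C₁∕n²` on `‖w‖_∞ = n ≥ 1`,
`Σ_{x ∈ box p N} |Σ_{y ∈ box p ℓ} K(x−y)·ω y| ≤ (|K 0| + 26·C₁·(N + ℓ)) · Σ_y |ω y|`. [folklore] -/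
theorem sum_box_abs_sum_mul_le (K : Zd 3 → ℝ) {C₁ : ℝ} (hC₁ : 0 ≤ C₁)
    (hK : ∀ (w : Zd 3) (n : ℕ), 1 ≤ n → w ∉ box 0 ((n : ℤ) - 1) → |K w| ≤ C₁ / (n : ℝ) ^ 2)
    (ω : Zd 3 → ℝ) (p : Zd 3) (ℓ N : ℕ) :
    ∑ x ∈ box p N, |∑ y ∈ box p ℓ, K (x - y) * ω y| ≤ (|K 0| + 26 * C₁ * ((N : ℝ) + ℓ)) * ∑ y ∈ box p ℓ, |ω y| := by
  -- pull the absolute value inside and swap the sums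
  have h1 : ∑ x ∈ box p N, |∑ y ∈ box p ℓ, K (x - y) * ω y| ≤ ∑ x ∈ box p N, ∑ y ∈ box p ℓ, |K (x - y)| * |ω y| :=
    Finset.sum_le_sum fun x _ => (Finset.abs_sum_le_sum_abs _ _).trans (le_of_eq (Finset.sum_congr rfl fun y _ => abs_mul _ _))
  refine h1.trans ?_
  rw [Finset.sum_comm, Finset.mul_sum]
  refine Finset.sum_le_sum fun y hy => ?_
  rw [← Finset.sum_mul]
  refine mul_le_mul_of_nonneg_right ?_ (abs_nonneg _)
  -- `Σ_{x ∈ box p N} |K(x − y)| = Σ_{x' ∈ box (p − y) N} |K x'| ≤ Σ_{box 0 (N+ℓ)} |K| ≤ |K 0| + 26 C₁ (N+ℓ)`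
  have hshift : ∑ x ∈ box p N, |K (x - y)| = ∑ x ∈ box (p - y) N, |K x| := by
    have := sum_box_add_right (fun x => |K x|) p (-y) (N : ℤ)
    simp only [← sub_eq_add_neg] at this
    exact this
  rw [hshift]
  have hsubset : box (p - y) (N : ℤ) ⊆ box 0 (((N + ℓ : ℕ)) : ℤ) := by
    rw [Nat.cast_add]
    exact box_sub_subset hy
  refine (Finset.sum_le_sum_of_subset_of_nonneg hsubset fun x _ _ => abs_nonneg _).trans ?_
  have hfin := sum_box_abs_le_of_decay K hC₁ hK (N + ℓ)
  push_cast at hfin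
  exact hfin

end Summit.QuantumFields.YangMills.Theorems.CovariantDischargeMatchedChargeKernelBounds

end
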